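import Summits.ResolutionOfSingularities.ResolutionOfSingularities.Theorems.HomologicalConductorNoZenoBirthDefs
import Summits.ResolutionOfSingularities.ResolutionOfSingularities.Theorems.HomologicalConductorNoZenoNoetherianCase
import Summits.ResolutionOfSingularities.ResolutionOfSingularities.Theorems.HomologicalConductorNoZenoTowerNoetherian
import Summits.ResolutionOfSingularities.ResolutionOfSingularities.Theorems.HomologicalConductorNoZenoDominanceInvariance
import Summits.ResolutionOfSingularities.ResolutionOfSingularities.Theorems.SyzygyFlatteningHigherRankTerminationRegularStep
import Literature.RingTheory.CohomologyAnnihilator.RegularLocalRing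
import Literature.AlgebraicGeometry.Resolution.RegularLocalRingsNormal
import Literature.AlgebraicGeometry.Resolution.RankOneReductionProofs
import HarnessLib

/-!
# Crux `NoZeno` (stmt-ResolutionOfSingularities-16483), line `birth` — the crux IS its kernel

Route `ResolutionOfSingularities/HomologicalConductor`, crux
`Summit.ResolutionOfSingularities.ResolutionOfSingularities.Theses.HomologicalConductor.NoZeno`
(valuative termination of the canonical normalised `ca`-tower, given `Persistence` and `StrictDrop`).

**`noZeno_iff_kernel` (kernel-checked certificate of the line's reduction).** `NoZeno` is
EQUIVALENT to its restriction to the towers dominated by NO noetherian valuation ring: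

  `NoZeno ↔ (Persistence → StrictDrop → ∀ p prime, ∀ datum (k, K, O, A),
     (∀ O', O' dominates the O-tower of A → ¬ IsNoetherianRing O') → ∃ m, IsRegularLocalRing (T_m))`

where "`O'` dominates the `O`-tower" is `∀ m, ∀ s ∈ tower O A m, s ∈ O' ∧ (s⁻¹ ∈ O' → s⁻¹ ∈ O)`.
`→` is specialisation. `←` is the composition of the line `birth` (v2) over its three LANDED stubs:
if some noetherian `O'` dominates the `O`-tower then `tower O' A = tower O A`
(`stub_dominanceInvariance`, p168418, fed by `stub_towerNoetherian`, p167526) and `StrictDrop` alone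
terminates the `O'`-tower (`stub_noetherianCase`, p167613) at the admissible datum `(k, K, O', A)`
(`k ⊆ A ⊆ T₀ ⊆ O'`); otherwise the kernel hypothesis applies verbatim.

So the crux's entire open content is the right-hand side with its extra hypothesis — the line's
registered `stub_kernel` (`Cruxes/NoZeno/Lines/birth.lean`, `Cruxes/NoZeno/KERNEL.md`).

**`tower_succ_eq_self_of_isRegularLocalRing` (no junk progress past a regular stage).** If `T_m` is
regular then `T_(m+1) = T_m`: `ca(T_m) = T_m` (tree `cohomologyAnnihilator_eq_top_iff_isRegularLocalRing`),
so every admissible `x` is an `O`-unit (`1 · x⁻¹ ∈ O`), inverted in `T_m` (a localisation at the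
centre), and `chart O T_m = T_m`; `nrm T_m = T_m` (regular ⇒ normal); `loc O T_m = T_m`
(idempotence of `loc`). So in the kernel one may assume every stage singular.
-/

noncomputable section

-- single-problem summit: the doubled namespace component `ResolutionOfSingularities` is forced
set_option linter.dupNamespace false

namespace Summit.ResolutionOfSingularities.ResolutionOfSingularities.Theorems.NoZeno.Birth

open Summit.ResolutionOfSingularities.ResolutionOfSingularities.Theses.HomologicalConductor

variable {k K : Type} [Field k] [Field K] [Algebra k K]

/-- **The crux `NoZeno` is equivalent to its kernel** — termination of the canonical normalised
`ca`-tower along the valuation rings `O` whose tower is dominated by NO noetherian valuation ring.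
`→`: specialise. `←`: if a noetherian `O'` dominates the `O`-tower, the `O'`-tower is the `O`-tower
(dominance invariance, noetherian stages) and `StrictDrop` terminates it (noetherian case at the
datum `(k, K, O', A)`); otherwise apply the kernel. [folklore] -/
theorem noZeno_iff_kernel : NoZeno ↔ (Persistence → StrictDrop → ∀ p : ℕ, p.Prime →
    ∀ (k K : Type) [Field k] [CharP k p] [Field K] [Algebra k K] (O : ValuationSubring K)
      (A : Subalgebra k K), (∀ c : k, algebraMap k K c ∈ O) → A.FG → IsFractionRing ↥A K →
      A.toSubring ≤ O.toSubring →
      (∀ O' : ValuationSubring K,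
        (∀ m : ℕ, ∀ s ∈ tower O A m, s ∈ O' ∧ (s⁻¹ ∈ O' → s⁻¹ ∈ O)) → ¬ IsNoetherianRing ↥O') →
      ∃ m : ℕ, IsRegularLocalRing ↥(tower O A m)) := by
  constructor
  · intro h hP hD p hp k K _ _ _ _ O A hk hfg hfr hAO _
    exact noZeno_iff.mp h hP hD p hp k K O A hk hfg hfr hAO
  · intro hK
    refine noZeno_iff.mpr fun hP hD p hp k K _ _ _ _ O A hk hfg hfr hAO => ?_
    by_cases h : ∃ O' : ValuationSubring K, IsNoetherianRing ↥O' ∧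
        ∀ m : ℕ, ∀ s ∈ tower O A m, s ∈ O' ∧ (s⁻¹ ∈ O' → s⁻¹ ∈ O)
    · obtain ⟨O', hNO', hdom⟩ := h
      have hTeq : ∀ m : ℕ, tower O' A m = tower O A m := fun m =>
        stub_dominanceInvariance k K O O' A hk hAO
          (fun n => stub_towerNoetherian k K O A hk hfg hfr hAO n) hdom m
      have hk' : ∀ c : k, algebraMap k K c ∈ O' :=
        fun c => (hdom 0 _ ((tower O A 0).algebraMap_mem c)).1
      have hAO' : A.toSubring ≤ O'.toSubring :=
        fun a ha => (hdom 0 a (SyzygyFlattening.self_le_locAt O A ha)).1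
      obtain ⟨m, hm⟩ := stub_noetherianCase hD p hp k K O' A hk' hfg hfr hAO' hNO'
      exact ⟨m, hTeq m ▸ hm⟩
    · exact hK hP hD p hp k K O A hk hfg hfr hAO (fun O' hdom hNO' => h ⟨O', hNO', hdom⟩)

/-! ## A regular stage is terminal -/

/-- Every stage of the tower contains `A` (membership form). [folklore] -/
theorem mem_tower_of_mem (O : ValuationSubring K) (A : Subalgebra k K) :
    ∀ (m : ℕ) (a : K), a ∈ A → a ∈ tower O A m := by
  intro m
  induction m with
  | zero => exact fun a ha => SyzygyFlattening.self_le_locAt O A ha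
  | succ n ih =>
    intro a ha
    rw [tower_succ]
    refine SyzygyFlattening.self_le_locAt O _ (SyzygyFlattening.self_le_nrm _ ?_)
    exact Algebra.subset_adjoin (Or.inl (ih a ha))

/-- Every stage of the tower is `loc O B` for some `B ⊆ O` (so it is its own localisation at the
centre and inverts its `O`-units). [folklore] -/
theorem exists_tower_eq_loc (O : ValuationSubring K) (A : Subalgebra k K)
    (hk : ∀ c : k, algebraMap k K c ∈ O) (hAO : A.toSubring ≤ O.toSubring) (m : ℕ) :
    ∃ B : Subalgebra k K, B.toSubring ≤ O.toSubring ∧ tower O A m = loc O B := by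
  cases m with
  | zero => exact ⟨A, hAO, rfl⟩
  | succ n =>
    refine ⟨nrm (chart O (tower O A n)), ?_, rfl⟩
    have hT : (tower O A n).toSubring ≤ O.toSubring :=
      fun x hx => mem_valuationSubring_of_mem_tower O hk hAO n x hx
    have hchart : (chart O (tower O A n)).toSubring ≤ O.toSubring := by
      refine SyzygyFlattening.adjoin_toSubring_le_valuationSubring O hk ?_
      rintro y (hy | ⟨c, hc, x, -, -, hadm, rfl⟩)
      · exact hT (Subalgebra.mem_toSubring.mpr hy)
      · exact hadm c hc
    exact SyzygyFlattening.nrm_toSubring_le O hk hchart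

/-- **A regular stage is terminal**: if `T_m` is a regular local ring then `T_(m+1) = T_m` (and so
the tower is stationary from `m` on). `ca(T_m) = T_m` makes every admissible denominator an
`O`-unit of `T_m`, inverted in `T_m = loc O B`, so `chart O T_m = T_m`; a regular local ring is
normal, so `nrm T_m = T_m`; and `loc O (loc O B) = loc O B`. [folklore] -/
theorem tower_succ_eq_self_of_isRegularLocalRing (O : ValuationSubring K) (A : Subalgebra k K)
    (hk : ∀ c : k, algebraMap k K c ∈ O) (hfr : IsFractionRing ↥A K)
    (hAO : A.toSubring ≤ O.toSubring) (m : ℕ) (hreg : IsRegularLocalRing ↥(tower O A m)) :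
    tower O A (m + 1) = tower O A m := by
  haveI := hreg
  haveI := hfr
  set T : Subalgebra k K := tower O A m with hTdef
  obtain ⟨B, hBO, hTB⟩ := exists_tower_eq_loc O A hk hAO m
  have hTO : T.toSubring ≤ O.toSubring :=
    fun x hx => mem_valuationSubring_of_mem_tower O hk hAO m x hx
  haveI : IsFractionRing ↥T K :=
    Literature.AlgebraicGeometry.Resolution.isFractionRing_subalgebra_of_le A T
      (fun a ha => mem_tower_of_mem O A m a ha)
  haveI : IsIntegrallyClosed ↥T :=
    Literature.AlgebraicGeometry.Resolution.isIntegrallyClosed_of_isRegularLocalRing ↥T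
  -- `1 ∈ ca T` since `T` is regular
  have h1 : (1 : K) ∈ ca T := by
    have htop := (Literature.RingTheory.CohomologyAnnihilator.cohomologyAnnihilator_eq_top_iff_isRegularLocalRing
      (R := ↥T)).mpr hreg
    have h1' : ((1 : ↥T) : K) ∈ ca T := (tn_coe_mem_ca_iff T 1).mpr (by rw [htop]; trivial)
    simpa using h1'
  -- the chart adds nothing
  have hchart : chart O T = T := by
    refine le_antisymm (Algebra.adjoin_le ?_) fun x hx => Algebra.subset_adjoin (Or.inl hx)
    rintro y (hy | ⟨c, hc, x, hx, hx0, hadm, rfl⟩)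
    · exact hy
    · have hxinvO : x⁻¹ ∈ O := by simpa using hadm 1 h1
      have hxT : x ∈ T := ca_subset T hx
      have hv : O.valuation x = 1 :=
        SyzygyFlattening.valuation_eq_one_of_inv_mem O (hTO (Subalgebra.mem_toSubring.mpr hxT))
          hxinvO hx0
      have hxinvT : x⁻¹ ∈ T := by
        rw [hTdef, hTB] at hxT ⊢
        exact SyzygyFlattening.inv_mem_locAt O B hBO hxT hv
      exact T.mul_mem (ca_subset T hc) hxinvT
  -- normalisation and localisation add nothing either
  have hnrm : nrm T = T := SyzygyFlattening.nrm_eq_self_of_isIntegrallyClosed T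
  have hloc : loc O T = T := by
    rw [hTdef, hTB]
    exact SyzygyFlattening.locAt_locAt O B hBO
  show tower O A (m + 1) = T
  rw [tower_succ, ← hTdef, hchart, hnrm, hloc]

end Summit.ResolutionOfSingularities.ResolutionOfSingularities.Theorems.NoZeno.Birth

end
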